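import Summits.CriticalPhenomena.PercolationContinuityZ3.Theorems.FK.Transplant.KNFreeTheorem6Sound
import Summits.CriticalPhenomena.PercolationContinuityZ3.Theorems.FK.Transplant.FreeBoundaryTransplantR3
import Summits.CriticalPhenomena.PercolationContinuityZ3.Theorems.FK.SamePContinuationUnconditional
import Summits.CriticalPhenomena.PercolationContinuityZ3.Theorems.FK.CriticalPointBounds
import HarnessLib

/-!
# FK-continuity transplant, FT-07 (g): what C2 ∧ C3b give — `¬UFSC0` at `p_c(q)`, and the transplant's END STATE
# record `_r3` consumed (lead ruling L8): FH ∧ TP_FK at `p` force `p_c(q) < p`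

Cell `fk-continuity` (bschramm), FRONTIER TRANSPLANT sub-cell, row FT-07; LEAF file (nothing imports it); support
file (`--supports stmt-CriticalPhenomena-4575`); builds on p205010 (kernel theorem, internal audit signed; external
expert review pending).

HONEST FRAMING. The two programme statements proved in the cell — C2 `FKContinuationPrinciple d q` (fkp-11,
`SamePContinuationUnconditional.lean`) and C3b `FKLawfulOfCriterion d q` (FT-07, `KNFreeTheorem6Sound.lean`) — are
UNCONDITIONAL for every `d` and every `q ≥ 1`, and so are the first two theorems below. The last two theorems
consume the transplant's record `ufsc0_of_freeBoundaryHypothesis_r3`, whose hypotheses are EXACTLY the two OPEN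
inputs: the free-boundary penetration hypothesis `FH d q p` (open at the same `p` for `q > 1`; ⇔ GRC Conj. (5.103)
via K1; barrier note `Literature.Barriers.CriticalPhenomena.SamePFreeBoundaryCriteria`) and Kozma–Nitzan's target
lemma for FK laws `KNFreeTargetHittable d q p` (TP_FK, open for `q > 1`). They are typed reductions, not a proof of
FK continuity: nothing here asserts FH or TP_FK, and `not_fh_and_targetHittable_at_critical` says precisely that
the two cannot BOTH hold at `p = p_c(q)` — the contrapositive form of the programme (C3a-type content stays open).

## What is here

* `rcCriticalProb_lt_of_ufsc0_of_one_le` — C2 ∧ C3b composed (FO-05 seam `rcCriticalProb_lt_of_ufsc0`): a `UFSC0`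
  witness at `(p, ε₀)` with `4ε₀ < 2⁻³²`, `0 < p < 1`, `q ≥ 1`, forces `p_c(q) < p`. Unconditional.
* `noUFSC0AtCritical` — FO-05's `NoUFSC0AtCritical d q ε₀` for `d ≥ 2`, `q ≥ 1`, `4ε₀ < 2⁻³²` (FO-12's leaf:
  seam `noUFSC0AtCritical_of` on `fkContinuationPrinciple`, `fkLawfulOfCriterion`, Grimmett Thm (5.5)). Unconditional.
* `rcCriticalProb_lt_of_fh_of_targetHittable` — END STATE consumed: for `d ≥ 3`, `q ≥ 1`, `p ∈ (0,1)`,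
  `FH d q p → KNFreeTargetHittable d q p → p_c(q) < p`. CONDITIONAL (both hypotheses OPEN for `q > 1`).
* `not_fh_and_targetHittable_at_critical` — hence at `p = p_c(q)` (`d ≥ 3`, `q ≥ 1`) FH and TP_FK do not both hold.

## References

* G. Kozma, S. Nitzan, arXiv:2401.12397 (2024), §1 p. 2 (approach 1), §4 Theorem 6. [KozmaNitzan2024]
* G. Grimmett, *The Random-Cluster Model*, Springer 2006: Thm. (5.5), Conj. (5.103). [Grimmett2006]
-/

noncomputable section

open MeasureTheory
open scoped ENNReal Classical

namespace Summit.CriticalPhenomena.PercolationContinuityZ3.Theorems.FK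

open Literature.Probability.Percolation Literature.Probability.LatticeModels
open Literature.Probability.Percolation.KozmaNitzan Literature.Barriers.CriticalPhenomena

variable {d : ℕ} {q ε₀ : ℝ}

/-- **C2 ∧ C3b, unconditional**: a `UFSC0 d q p r ε₀` witness with `4ε₀ < 2⁻³²`, `0 < p < 1`, `q ≥ 1` forces
`p_c(q) < p`. [cite: KozmaNitzan2024, §1 p. 2 (approach 1), §4 Theorem 6] -/
theorem rcCriticalProb_lt_of_ufsc0_of_one_le (hq : 1 ≤ q) (hε₀ : 4 * ε₀ < (1 / 2 : ℝ) ^ 32) {p : unitInterval}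
    (hp0 : 0 < (p : ℝ)) (hp1 : (p : ℝ) < 1) {r : ℕ} (hU : UFSC0 d q p r ε₀) : rcCriticalProb d q < p :=
  rcCriticalProb_lt_of_ufsc0 (fkContinuationPrinciple hq) (fkLawfulOfCriterion hq) hε₀ hp0 hp1 hU

/-- **`¬UFSC0` at criticality, unconditional** (FO-05 `NoUFSC0AtCritical`; FO-12's leaf): for `d ≥ 2`, `q ≥ 1`
and `4ε₀ < 2⁻³²`, the uniform finite-size criterion fails at `p = p_c(q)` at every scale.
[cite: Grimmett2006, Thm. (5.5), Conj. (5.103)] -/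
theorem noUFSC0AtCritical (hd : 2 ≤ d) (hq : 1 ≤ q) (hε₀ : 4 * ε₀ < (1 / 2 : ℝ) ^ 32) :
    NoUFSC0AtCritical d q ε₀ :=
  noUFSC0AtCritical_of (fkContinuationPrinciple hq) (fkLawfulOfCriterion hq) hε₀
    (rcCriticalProb_pos (by omega) hq) (rcCriticalProb_lt_one hd hq)

/-- **The transplant's END STATE consumed** (lead ruling L8; CONDITIONAL on FH AND TP_FK, both OPEN for `q > 1`):
for `d ≥ 3`, `q ≥ 1`, `p ∈ (0,1)`, the free-boundary penetration hypothesis at `p` and Kozma–Nitzan's target lemma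
for FK laws at `p` force `p_c(q) < p` — `_r3` gives `UFSC0 d q p r 2⁻³⁵`, then C3b and C2.
[cite: KozmaNitzan2024, §1 p. 2 (approach 1), §4 Theorem 6] [cite: Grimmett2006, Conj. (5.103)] -/
theorem rcCriticalProb_lt_of_fh_of_targetHittable (hd : 3 ≤ d) (hq : 1 ≤ q) (p : unitInterval)
    (hp : (p : ℝ) ∈ Set.Ioo 0 1) (hFH : FH d q p) (h_tgt : KNFreeTargetHittable d q p) :
    rcCriticalProb d q < p := by
  have hε : (0 : ℝ) < (1 / 2) ^ 35 := by positivity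
  obtain ⟨r, hU⟩ := ufsc0_of_freeBoundaryHypothesis_r3 hd hq hε p hp hFH h_tgt
  exact rcCriticalProb_lt_of_ufsc0_of_one_le hq (by norm_num) hp.1 hp.2 hU

/-- **At criticality FH and TP_FK do not both hold** (`d ≥ 3`, `q ≥ 1`): the contrapositive form of the
conditional programme — unconditional as stated, and silent on which of the two fails.
[cite: Grimmett2006, Thm. (5.5), Conj. (5.103)] -/
theorem not_fh_and_targetHittable_at_critical (hd : 3 ≤ d) (hq : 1 ≤ q) :
    ¬(FH d q ⟨rcCriticalProb d q, rcCriticalProb_mem_Icc d q⟩ ∧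
      KNFreeTargetHittable d q ⟨rcCriticalProb d q, rcCriticalProb_mem_Icc d q⟩) := by
  rintro ⟨hFH, h_tgt⟩
  have hpc := rcCriticalProb_mem_Ioo (show 2 ≤ d by omega) hq
  exact lt_irrefl _ (rcCriticalProb_lt_of_fh_of_targetHittable hd hq ⟨_, rcCriticalProb_mem_Icc d q⟩ hpc hFH h_tgt)

end Summit.CriticalPhenomena.PercolationContinuityZ3.Theorems.FK

end
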